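import Summits.CriticalPhenomena.PercolationContinuityZ3.Theorems.PercNearOneGluingNoHeavyLowerTailPatternSunflower
import HarnessLib

/-!
# `NoHeavyLowerTail` (stmt-CriticalPhenomena-4575) — the BOTTOM (order-dual) four-point sunflower row

Support file (prover prim-gen-kcluster gen 6, k-cluster line; `--supports stmt-CriticalPhenomena-4575`).  No definitions
beyond two Boolean pattern tests, no named facts, no sorries.

WHY.  The exact pseudo-law `z*` (ttrl `wf3lp/fakelaw_U13_noregime_comp3+shk+shkg.json`) that obstructs every
product-multiplier certificate of Kozma–Nitzan's Question 7 at `|A| = 3` over two-set exchange + Harris + Reimer + all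
sunflower rows used so far (memo run/shared/lean/prim/prim-gen-kcluster/KCLUSTER-gen6.md §6) VIOLATES the following
instance of Gladkov's strong Harris–Kleitman inequality, which no certificate search had in its row family: on four of the
five terminals (numbers `0,1,2,3`; pairs `01,02,03,12,13,23` = pattern bits `0,1,2,4,5,7`), with
`B = "the four are pairwise separated"`, the six petals `C_ij = "exactly the pair ij is joined among the four"` and
`A = "at least two of the six pairs are joined"`:
      `e₂(μ(C_01), …, μ(C_23)) ≤ μ(A) · μ(B)`,  i.e.  `(Σ μ C)² − Σ (μ C)² ≤ 2 μ(A) μ(B)`.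
`A` and every `A ∪ C_ij` are increasing (adding an open edge to a configuration with exactly the pair `ij` joined keeps `ij`
joined), the petals are pairwise disjoint and disjoint from `A`, and `B` is the complement — so this is
`PatternSunflower.patternSunflower` (tree, from `prodBernoulli_strongHarris`) with six petals; the four side conditions are
decided on the 52 consistent patterns.  Exact value on `z*`: `μ(A)μ(B) − e₂ = −12 442 401 · 10⁻¹²`.
* `quadLow m` — number of joined pairs among terminals `0,1,2,3` in pattern `m`; `dual4A`, `dual4C` — the tests;
* `dualSunflower_four` — the row, for every weighted graph on `Fin n` and every placement `v` of the five terminals.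
[cite: Gladkov2024StrongFKG, Thm. 2.1]
-/

noncomputable section

namespace Summit.CriticalPhenomena.PercolationContinuityZ3.Theorems

open MeasureTheory Set Literature.Probability.Percolation
open Literature.Probability.LatticeModels (prodBernoulli)
open scoped Classical BigOperators
open PatternCells CertCells PatternSunflower

namespace PatternSunflower

variable {n : ℕ}

/-- The pattern bits of the six pairs among terminals `0,1,2,3` (pair numbering of `PatternCells.pairFst/pairSnd`:
`01 ↦ 0, 02 ↦ 1, 03 ↦ 2, 12 ↦ 4, 13 ↦ 5, 23 ↦ 7`). [folklore] -/
def lowPairBit : Fin 6 → ℕ := ![0, 1, 2, 4, 5, 7]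

/-- Number of joined pairs among terminals `0,1,2,3` in pattern `m`. [folklore] -/
def quadLow (m : ℕ) : ℕ := ((List.finRange 6).filter fun i => Nat.testBit m (lowPairBit i)).length

/-- Test of the top event `A`: at least two of the six pairs among terminals `0,1,2,3` are joined. [folklore] -/
def dual4A (m : ℕ) : Bool := decide (2 ≤ quadLow m)

/-- Test of the petal `C_i`: exactly one pair among terminals `0,1,2,3` is joined, namely pair `i`. [folklore] -/
def dual4C (i : Fin 6) (m : ℕ) : Bool := decide (quadLow m = 1) && Nat.testBit m (lowPairBit i)

/-- **The bottom four-point sunflower row.**  For every weighted graph on `Fin n` and every placement `v` of the five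
terminals, with `C_i` = "exactly the pair `i` among terminals `0,1,2,3` is joined" (`i` over the six pairs),
`A` = "at least two of those pairs are joined" and `B = (A ∪ ⋃ C_i)ᶜ` = "terminals `0,1,2,3` pairwise separated":
`(Σ_i μ(C_i))² − Σ_i μ(C_i)² ≤ 2 μ(A) μ(B)`, i.e. `e₂(μ(C)) ≤ μ(A)μ(B)` — Gladkov's Thm. 2.1 via `patternSunflower`,
the side conditions (monotonicity of `A` and of each `A ∪ C_i`, disjointness) decided on the 52 consistent patterns.
[cite: Gladkov2024StrongFKG, Thm. 2.1] -/
theorem dualSunflower_four (w : Sym2 (Fin n) → unitInterval) (v : Fin 5 → Fin n) :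
    (∑ i : Fin 6, (prodBernoulli w).real (PatEvent v (dual4C i))) ^ 2 -
        ∑ i : Fin 6, (prodBernoulli w).real (PatEvent v (dual4C i)) ^ 2 ≤
      2 * ((prodBernoulli w).real (PatEvent v dual4A) *
        (prodBernoulli w).real (PatEvent v dual4A ∪ ⋃ i ∈ (Finset.univ : Finset (Fin 6)),
          PatEvent v (dual4C i))ᶜ) := by
  have h := patternSunflower w v (Finset.univ : Finset (Fin 6)) dual4A dual4C (by decide)
    (fun i _ => by fin_cases i <;> decide) (fun i _ j _ hij => by fin_cases i <;> fin_cases j <;> first | exact absurd rfl hij | decide)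
    (fun i _ => by fin_cases i <;> decide)
  simpa using h

end PatternSunflower

end Summit.CriticalPhenomena.PercolationContinuityZ3.Theorems

end
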